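import Mathlib
import Summits.RiemannHypothesis.RiemannHypothesis.Theses.RuelleBand
import Literature.NumberTheory.LFunctions.WeilExplicit

/-!
# Sketch — crux `ExactFirstBand` (stmt-RiemannHypothesis-2061), crux-ideate round 1, ideator 1

First lemmas of the two idea cards of this seat (statements elaborate; the cheap ones are proved):

* card `fe-even-weil-sector`  — `IsEvenRealTest`, `EvenWeilPositivity`, `EvenWeilCriterion`,
  `evenPolar`, `joukowski_im`, `joukowski_real_iff` (the finite "X-shape" lemma of the
  function-field face), `EvenSectorFiniteEngine`;
* card `cosh-casimir-realisation` — `CoshEngine`, `CoshRealisation`, `exactFirstBand_of_cosh`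
  (kernel-checked composition), `ExactToCosh` (honesty), `HypothesisFree`,
  `SinglePrimeReality`, `TwoPrimesGlue`.
-/

noncomputable section

open Complex ComplexConjugate
open scoped InnerProductSpace
open Literature.NumberTheory.LFunctions
open Summit.RiemannHypothesis.RiemannHypothesis.Theses.RuelleBand

namespace Summit.RiemannHypothesis.RiemannHypothesis.Cruxes.ExactFirstBand.Ideator1

/-! ## Card A — the functional-equation-even sector of Weil's form -/

/-- Real test functions invariant under the functional-equation involution `t ↦ -t`
(Bombieri's `f = f*`, "even"; in the tree's additive `1/2`-symmetric normalisation this is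
plain evenness of `g`). -/
def IsEvenRealTest (g : ℝ → ℂ) : Prop :=
  IsWeilTest g ∧ (∀ t, g (-t) = g t) ∧ (∀ t, (g t).im = 0)

/-- Weil positivity restricted to the even real sector. -/
def EvenWeilPositivity : Prop :=
  ∀ g : ℝ → ℂ, IsEvenRealTest g → 0 ≤ (weilQuadratic g).re

/-- FIRST LEMMA (card A): the even sector decides exactly the DFG shape. `←` is RH → Weil
positivity (tree: `WeilPositivity.of_riemannHypothesis`) restricted; `→` is the even analogue of
`Literature.WeilConverse.riemannHypothesis_of_zeroSide_nonneg` (real-coefficient symmetric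
translate mixing `g + Σ cₖ (g(· - xₖ) + g(· + xₖ))`; no real zeros needed or produced). -/
def EvenWeilCriterion : Prop :=
  EvenWeilPositivity ↔ ExactFirstBand

/-- In the even real sector the polar term of `Q(g) = W(g ⋆ g̃)` is the POSITIVE rank-one form
`2 ĝ(0)²` (`ĝ(1) = ĝ(0)` real); in the odd real sector it is `-2 ĝ(0)²`. -/
def evenPolar : Prop :=
  ∀ g : ℝ → ℂ, IsEvenRealTest g →
    weilPolarTerm (weilConv g (weilReflect g)) = 2 * (weilMellin g 0) ^ 2 ∧
      (weilMellin g 0).im = 0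

/-- Joukowski map: `Im (u + u⁻¹) = Im u · (1 - |u|⁻²)`. -/
theorem joukowski_im (u : ℂ) : (u + u⁻¹).im = u.im * (1 - (Complex.normSq u)⁻¹) := by
  rw [Complex.add_im, Complex.inv_im]
  ring

/-- The finite "exact first band" lemma (function-field face of card A): for `u ≠ 0`,
`u + u⁻¹` is real iff `u` lies on the unit circle or on the real axis. With `u = e^{t(ρ - 1/2)}`
this is `cosh(t(ρ - 1/2)) ∈ ℝ ↔ (Re ρ = 1/2 ∨ t·Im ρ ∈ πℤ)`; with `u = α/√q` (Frobenius
eigenvalue) it is "on the critical circle or real". -/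
theorem joukowski_real_iff (u : ℂ) (hu : u ≠ 0) :
    (u + u⁻¹).im = 0 ↔ Complex.normSq u = 1 ∨ u.im = 0 := by
  rw [joukowski_im, mul_eq_zero]
  have h0 : Complex.normSq u ≠ 0 := (Complex.normSq_pos.2 hu).ne'
  constructor
  · rintro (h | h)
    · exact Or.inr h
    · left
      have h1 : (Complex.normSq u)⁻¹ = 1 := by linarith
      have := congrArg (fun x : ℝ => x⁻¹) h1
      simpa using this
  · rintro (h | h)
    · right; rw [h]; simp
    · exact Or.inl h

/-- EVEN-SECTOR FINITE ENGINE (the linear-algebra core of "Castelnuovo–Severi on symmetric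
correspondences ⇒ DFG shape"): for a conjugation-closed finite family `w`, positivity of
`Σ_i p(w_i)²` for every REAL polynomial `p` holds iff every `w_i` is real. Applied to
`w_i = u_i + u_i⁻¹` and `joukowski_real_iff`: the even sector pins `u_i` to circle ∪ real axis
and is blind to nothing else. -/
def EvenSectorFiniteEngine : Prop :=
  ∀ (n : ℕ) (w : Fin n → ℂ), (∃ σ : Equiv.Perm (Fin n), ∀ i, w (σ i) = conj (w i)) →
    ((∀ p : Polynomial ℝ, 0 ≤ (∑ i, (Polynomial.aeval (w i) p) ^ 2).re) ↔ ∀ i, (w i).im = 0)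

/-! ## Card B — the cosh / Casimir realisation (typed rung-X engine of the band ladder) -/

/-- COSH ENGINE (provable now, one line per eigenvector): a one-parameter group of bounded
operators whose time-symmetrisation `T t + T (-t)` ("2 cosh of the generator") is self-adjoint
for every `t` has all its joint eigen-characters `e^{tz}` with `z` purely imaginary or real. -/
def CoshEngine : Prop :=
  ∀ (H : Type) [NormedAddCommGroup H] [InnerProductSpace ℂ H] [CompleteSpace H]
    (T : ℝ → H →L[ℂ] H), T 0 = ContinuousLinearMap.id ℂ H →
    (∀ s t : ℝ, T (s + t) = (T s).comp (T t)) →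
    (∀ t : ℝ, IsSelfAdjoint (T t + T (-t))) →
    ∀ (z : ℂ) (v : H), v ≠ 0 → (∀ t : ℝ, T t v = Complex.exp (↑t * z) • v) →
      z.re = 0 ∨ z.im = 0


/-- `Im cosh(t z) = sinh(t Re z) · sin(t Im z)` for real `t`. -/
theorem cosh_real_mul_im (t : ℝ) (z : ℂ) :
    (Complex.cosh (↑t * z)).im = Real.sinh (t * z.re) * Real.sin (t * z.im) := by
  have hz : (↑t * z : ℂ) = ((t * z.re : ℝ) : ℂ) + ((t * z.im : ℝ) : ℂ) * I := by
    apply Complex.ext <;> simp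
  rw [hz, Complex.cosh_add, Complex.cosh_mul_I, Complex.sinh_mul_I]
  rw [← Complex.ofReal_cosh, ← Complex.ofReal_sinh, ← Complex.ofReal_cos, ← Complex.ofReal_sin]
  simp only [Complex.add_im, Complex.mul_im, Complex.ofReal_re, Complex.ofReal_im, Complex.I_re,
    Complex.I_im]
  ring

/-- Scalar core of `CoshEngine`: if `cosh(t z)` is real for every real time `t`, then `z` is purely
imaginary or real. (Take `t = 1 / Im z`.) -/
theorem re_eq_zero_or_im_eq_zero_of_cosh_real (z : ℂ)
    (h : ∀ t : ℝ, (Complex.cosh (↑t * z)).im = 0) : z.re = 0 ∨ z.im = 0 := by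
  by_contra hcon
  push Not at hcon
  obtain ⟨hre, him⟩ := hcon
  have ht := h (1 / z.im)
  rw [cosh_real_mul_im] at ht
  have h1 : (1 / z.im) * z.im = 1 := by field_simp
  rw [h1] at ht
  have hsin : Real.sin 1 ≠ 0 :=
    (Real.sin_pos_of_pos_of_lt_pi one_pos (by linarith [Real.pi_gt_three])).ne'
  have hsinh : Real.sinh (1 / z.im * z.re) ≠ 0 := by
    rw [Real.sinh_ne_zero]
    exact mul_ne_zero (one_div_ne_zero him) hre
  exact mul_ne_zero hsinh hsin ht

/-- `CoshEngine` holds (the eigenvalue of a self-adjoint operator at an eigenvector is real). -/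
theorem coshEngine_holds : CoshEngine := by
  intro H _ _ _ T hT0 hgrp hsa z v hv hTv
  apply re_eq_zero_or_im_eq_zero_of_cosh_real
  intro t
  -- ⟪(T t + T (-t)) v, v⟫ = (e^{tz} + e^{-tz}) ‖v‖², and it is real by self-adjointness
  have hSA := hsa t
  have hv2 : (T t + T (-t)) v = (Complex.exp (↑t * z) + Complex.exp (↑(-t) * z)) • v := by
    rw [ContinuousLinearMap.add_apply]; rw [hTv t, hTv (-t), add_smul]
  have hreal : (⟪(T t + T (-t)) v, v⟫_ℂ).im = 0 := by
    have h1 : ⟪(T t + T (-t)) v, v⟫_ℂ = ⟪v, (T t + T (-t)) v⟫_ℂ := by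
      rw [← ContinuousLinearMap.adjoint_inner_left, hSA.adjoint_eq]
    have h2 : ⟪v, (T t + T (-t)) v⟫_ℂ = conj ⟪(T t + T (-t)) v, v⟫_ℂ := by
      rw [inner_conj_symm]
    rw [h2] at h1
    have := congrArg Complex.im h1
    simp only [Complex.conj_im] at this
    linarith
  rw [hv2, inner_smul_left] at hreal
  have hvv : ⟪v, v⟫_ℂ = ((‖v‖ ^ 2 : ℝ) : ℂ) := by
    rw [inner_self_eq_norm_sq_to_K]; norm_cast
  rw [hvv] at hreal
  have hnorm : (‖v‖ ^ 2 : ℝ) ≠ 0 := by positivity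
  have hcosh : Complex.exp (↑t * z) + Complex.exp (↑(-t) * z) = 2 * Complex.cosh (↑t * z) := by
    rw [Complex.cosh, show (↑(-t) * z : ℂ) = -(↑t * z) by push_cast; ring]
    ring
  rw [hcosh] at hreal
  -- im (conj (2 cosh(tz)) * ‖v‖²) = -2 im(cosh(tz)) ‖v‖²
  simp only [map_mul, Complex.mul_im, Complex.conj_re, Complex.conj_im, Complex.ofReal_re,
    Complex.ofReal_im, mul_zero, zero_add, map_ofNat] at hreal
  have : -(Complex.cosh (↑t * z)).im * (‖v‖ ^ 2) * 2 = 0 := by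
    have h := hreal
    simp only [Complex.re_ofNat, Complex.im_ofNat] at h
    nlinarith [h]
  have h2 : (Complex.cosh (↑t * z)).im * (‖v‖ ^ 2) = 0 := by linarith
  rcases mul_eq_zero.1 h2 with h3 | h3
  · exact h3
  · exact absurd h3 hnorm

/-- COSH REALISATION (typed shadow of X, one rung above the route's `BandRealisation`):
a group whose cosh-family is self-adjoint and which carries every non-trivial zero as a joint
eigenvalue of character `e^{t(ρ - 1/2)}`. HONEST: `↔ ExactFirstBand` (`exactFirstBand_of_cosh`,
`ExactToCosh`); the content is the intended witness (card text). -/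
def CoshRealisation : Prop :=
  ∃ (H : Type) (_ : NormedAddCommGroup H) (_ : InnerProductSpace ℂ H) (_ : CompleteSpace H)
    (T : ℝ → H →L[ℂ] H), T 0 = ContinuousLinearMap.id ℂ H ∧
    (∀ s t : ℝ, T (s + t) = (T s).comp (T t)) ∧
    (∀ t : ℝ, IsSelfAdjoint (T t + T (-t))) ∧
    (∀ s : ℂ, riemannZeta s = 0 → 0 < s.re → s.re < 1 →
      ∃ v : H, v ≠ 0 ∧ ∀ t : ℝ, T t v = Complex.exp (↑t * (s - 1 / 2)) • v)

/-- The composition `CoshEngine → CoshRealisation → ExactFirstBand`, kernel-checked. -/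
theorem exactFirstBand_of_cosh (hE : CoshEngine) (hR : CoshRealisation) : ExactFirstBand := by
  intro s hs h0 h1
  obtain ⟨H, i1, i2, i3, T, hT0, hgrp, hsa, hzero⟩ := hR
  obtain ⟨v, hv, hTv⟩ := hzero s hs h0 h1
  have h := @hE H i1 i2 i3 T hT0 hgrp hsa (s - 1 / 2) v hv hTv
  rcases h with h | h
  · left
    have : (s - 1 / 2).re = s.re - 1 / 2 := by simp
    rw [this] at h
    linarith
  · right
    simpa using h

/-- Honesty (calibration): under X the diagonal group on `ℓ²` over the zero set, with
`T t = diag(e^{t(ρ-1/2)})`, has `T t + T(-t) = diag(2cosh(t(ρ-1/2)))` with REAL diagonal, hence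
self-adjoint. So `CoshRealisation ↔ ExactFirstBand` (M: diagonal operators on `lp`). -/
def ExactToCosh : Prop :=
  ExactFirstBand → CoshRealisation

/-- The strip hypotheses of the crux are redundant: the DFG shape is the hypothesis-free statement
"every zero of `ζ` is on the critical line or on the real axis" (trivial zeros are real; no
zeros on `re s ≥ 1`, `riemannZeta_ne_zero_of_one_le_re`; zeros with `re s ≤ 0` are trivial,
route file `closes`). Provable now (S). -/
def HypothesisFree : Prop :=
  ExactFirstBand ↔ ∀ s : ℂ, riemannZeta s = 0 → s.re = 1 / 2 ∨ s.im = 0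

/-- Single-prime (single-time) cosh reality: the Hecke-symmetrised flow at time `log p` has real
eigenvalue at every zero. By `joukowski_real_iff` this only says
`re ρ = 1/2 ∨ im ρ ∈ (π / log p) ℤ`; the second band `{3/4 + 2πik/log 2}` of the sibling
Disproof's `zetaTwistedAtTwo` satisfies it at `p = 2` (cosh((s_k - 1/2) log 2) = cosh(log 2 / 4)). -/
def SinglePrimeReality (p : ℕ) : Prop :=
  ∀ s : ℂ, riemannZeta s = 0 → 0 < s.re → s.re < 1 →
    (Complex.cosh ((s - 1 / 2) * (Real.log p : ℂ))).im = 0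

/-- TWO PRIMES GLUE: reality at two multiplicatively independent primes is exactly X
(`log 2 / log 3` irrational ⇐ unique factorisation). Provable now (S/M). -/
def TwoPrimesGlue : Prop :=
  SinglePrimeReality 2 → SinglePrimeReality 3 → ExactFirstBand

end Summit.RiemannHypothesis.RiemannHypothesis.Cruxes.ExactFirstBand.Ideator1
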